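/-
Copyright (c) 2026 the pub-hodgecm-mathlib formalisation cell (harness21).  Prover seat hodgecm-mathlib-K2E4-p10 (g5), Track B ∕ K2-LIT, h413 =
`stmt-HodgeConjecture-24833`, ENGINE E1, campaign «EIS-WHITTAKER-3» WAVE 2, W3₃ FILE B1 (dealer K2E1-plan (g5) 2026-09-04T09:01:41Z «→ then W3₃ FILE B»): the `hprod` letter of
★ W3₃ FILE A `K2E1WhittakerCoefficientEulerProductU3` (p858568) — the FINITE WHITTAKER EULER PRODUCT of the `U(2,1)` intertwining integrand TWISTED BY THE ADDITIVE CHARACTER, in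
★ (q10) FILE 3's `(𝔸_{L⁺,f})³` currency (★ `K2E1IntertwiningScalarEulerProductU3Finite`, p858710).
-/
import Summits.HodgeConjecture.HodgeConjecture.Theorems.K2E1IntertwiningLocalMeanCMU3               -- ★ (3-iii-b1): `localHeight_eq_one_of_mem_integralBox` (+ ★ (3-iii-a) `continuous_localHeight_rpow`, the local height `Q_v`)
import Summits.HodgeConjecture.HodgeConjecture.Theorems.K2E1IntertwiningFiniteHeightDictionaryU3    -- ★ (3-iv-a): `quadraticFiniteAdeleMap_apply_placesOver` (`Ψ^∞(a₀,a₁)_w = Ψ_v(a₀|_v,a₁|_v)_w`), ★ `finprod_eq_finprod_prod_placesOver`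
import Summits.HodgeConjecture.HodgeConjecture.Theorems.K2E1AdelicFourierCoeffEulerProduct          -- ★ W3-engine (rank one): `coe_finiteAdeleAddChar_mul_eq_finprod` (`ψ_f(ξb) = ∏ᶠ_w ψ_w(ξ b_w)`), `finite_mulSupport_localFactor`
import Summits.HodgeConjecture.HodgeConjecture.Theorems.AdelicProductIntegral                       -- ★ p858070: Tate 3.3.1 for integrable factorizable functions on `(𝔸_{K,f})^ι`
import HarnessLib

/-!
# K2·E1 — `K2E1WhittakerCoefficientEulerProductU3B` (W3₃ FILE B1): THE ψ-TWISTED FINITE EULER PRODUCT —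
# `μ(𝒪̂³)⁻¹·∫_{(𝔸_{L⁺,f})³} (∏ᶠ_v Q_v(x_v)^{−z})·ψ_{L,f}(ξ·Ψ^∞(x₀,x₁)) dμ = ∏'_v W_v(ξ, z)`, `W_v(ξ, z) := ν_v(𝒪_v³)⁻¹·∫_{(L⁺_v)³} Q_v(p)^{−z}·∏_{w∣v} ψ_{L,w}(ξ·Ψ_v(p₀,p₁)_w) dν_v`
# (Tate's Theorem 3.3.1 at `ι = Fin 3` with the character of `𝔸_L` inserted) — THE `hprod` LETTER OF ★ W3₃ FILE A `whittakerCoeff_eq_prod_of_inputs`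

Track B ∕ K2-LIT, crux h413 = `stmt-HodgeConjecture-24833`, route of record `HCCMUnconditional`; cell `hodgecm-mathlib`, squad K2, ENGINE E1 (campaign «EIS-WHITTAKER-3», WAVE 2,
rung W3₃ = the Whittaker coefficient of the spherical Eisenstein section on `U(2,1)_{L∕L⁺}` as a partial Euler product).  Prover seat `hodgecm-mathlib-K2E4-p10` (g5).  THEOREMS
ONLY (no `def`, no `instance`, no notation, no named-fact hypothesis, no `sorry`; default heartbeats); lane `--supports stmt-HodgeConjecture-24833 --as helper` (count-neutral).
CURRENCY = ★ (q10) FILE 3 (`K2E1IntertwiningScalarEulerProductU3Finite`): `x : Fin 3 → 𝔸_{L⁺,f}` (the `{1,δ}` transport `X = Ψ^∞(x₀,x₁) = (x₀)_{𝔸_{L,f}} + (x₁)_{𝔸_{L,f}}·δ`,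
★ `quadraticFiniteAdeleMap` = ★ `K2E1FiniteAdeleBasisTransport`), the local height `Q_v(p) = ∏_{w∣v} max(1, ‖Ψ_v(p₀,p₁)_w‖, ‖(ι_v(p₂)δ − ι_v(½)Ψ_v·σΨ_v)_w‖)` of ★ (3-iii-a) VERBATIM,
Tate's local characters `ψ_{L,w}` = ★ `adeleAddCharAt L w` and `ψ_{L,f}` = ★ `finiteAdeleAddChar L` (`ψ_{L,f}(y) = ∏ᶠ_w ψ_{L,w}(y_w)`, ★ W3-engine `coe_finiteAdeleAddChar_mul_eq_finprod`).

THE MATHEMATICS [TateThesis1967, Thm 3.3.1; Bump1997, §3.7; Rogawski1990, §4.5].  After unfolding and the `{1,δ}` transport (FILE B2, not here), the finite Whittaker integral of the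
spherical section is `∫_{(𝔸_{L⁺,f})³} F(x)·ψ_{L,f}(ξ·Ψ^∞(x₀,x₁)) dμ` with `F(x) = ∏ᶠ_v Q_v(x_v)^{−z}` ★ FILE 3's integrand at a complex exponent.  Regrouping the places of
`L` above those of `L⁺` (★ `finprod_eq_finprod_prod_placesOver`) and reading `Ψ^∞` place by place (★ (3-iv-a) `quadraticFiniteAdeleMap_apply_placesOver`) makes the integrand the
FACTORIZABLE function `∏ᶠ_v f_v(x_v)`, `f_v(p) = Q_v(p)^{−z}·∏_{w∣v} ψ_{L,w}(ξ·Ψ_v(p₀,p₁)_w)` (§2); each `f_v` is continuous and `= 1` on the box `𝒪_v³` at every GOOD place `v ∉ S₀`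
(`Q_v = 1` there, ★ (3-iii-b1); `Ψ_v(𝒪_v²) ⊆ ∏_w 𝒪_w` as `δ` is a `w`-unit; `ψ_{L,w} = 1` on `𝒪_w`, ★ `adeleAddCharAt_eq_one_of_mem`; `ξ ∈ 𝒪_w` — the letter `hξ`, true off a finite
set, §1 `exists_finset_forall_coe_mem_adicCompletionIntegers`), and `|ψ| = 1` transfers integrability from `F` (§3).  Tate's Theorem 3.3.1 (★ `AdelicProductIntegral`) then gives
**`HasProd (v ↦ W_v(ξ, z)) (μ(𝒪̂³)⁻¹·∫ F·ψ_{L,f}(ξΨ^∞) dμ)`** — the `hprod` hypothesis of ★ W3₃ FILE A `whittakerCoeff_eq_prod_of_inputs` (which regroups it, with the unit values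
★ D-W1 ∕ C1₃ ∕ D-W4, as `(∏_{v∈S} W_v)·[ζ^S_{L⁺}(z)L^S(z,ε)L^S(2z−1,ε)]⁻¹`).
* §0 (generic `K`, `ι`) `finite_mulSupport_localFactor_pi`, **`continuous_finprod_localFactor`** (a factorizable function with continuous local factors `= 1` on the boxes off `S₀`
  is continuous on `(𝔸_{K,f})^ι` — the measurability half of every `hint` letter).
* §1 (one place `v`) `continuous_localHeight`, `quadraticLocalEquiv_apply_mem_adicCompletionIntegers`, `ofReal_localHeight_cpow_eq_one_of_mem_integralBox`,
  `prod_adeleAddCharAt_eq_one_of_mem_integralBox`, **`continuous_twistedLocalFactor`**, **`twistedLocalFactor_eq_one_of_mem_integralBox`**, `norm_twistedLocalFactor_eq`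
  (`|f_v| = Q_v^{−Re z}`); `exists_finset_forall_coe_mem_adicCompletionIntegers` (the letter `hξ` holds off a finite set).
* §2 **`finprod_twistedLocalFactor_eq`**: `∏ᶠ_v f_v(x_v) = F(x)·ψ_{L,f}(ξ·Ψ^∞(x₀,x₁))` pointwise.
* §3 HEAD **`hasProd_localWhittaker_three`** (letters: `hgood` as ★ FILE 3, `hξ`, and FILE 3's integrability letter `hint` at the complex exponent `z`).
HONEST LABEL: HC_CM is proved only modulo the 7 printed citations (2 remaining named inputs: hLiu418 = `stmt-HodgeConjecture-24832`, h413 = `stmt-HodgeConjecture-24833`) until rung 0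
closes; this file asserts no named fact and closes no socket; count-neutral; §3 is conditional only on its displayed letters (`hgood`, `hξ`, `hint`).

## References
* [TateThesis1967] J. Tate, *Fourier analysis in number fields and Hecke's zeta-functions*, in Cassels–Fröhlich (1967), Ch. XV: Thm 3.3.1, Lemma 3.3.2, §4.1.
* [Bump1997] D. Bump, *Automorphic Forms and Representations* (1997): §3.7 (Whittaker coefficients of Eisenstein series as Euler products).
* [Rogawski1990] J. D. Rogawski, *Automorphic Representations of Unitary Groups in Three Variables* (1990): §4.5.
* [CasselsFrohlichANT1967] J. W. S. Cassels, *Global fields*, ibid. Ch. II §11, §14 (places of `L` above a place of `L⁺`; `L ⊗ L⁺_v = ∏_{w∣v} L_w`).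
-/

set_option autoImplicit false
set_option linter.dupNamespace false -- the mandated namespace repeats `HodgeConjecture.HodgeConjecture`

noncomputable section

open MeasureTheory NumberField IsDedekindDomain Filter Topology Function Set
open scoped NNReal ENNReal
open Literature.NumberTheory.Automorphic Literature.NumberTheory.Automorphic.UnitaryGroup Literature.NumberTheory.GaloisRepresentations
open Literature.NumberTheory.GaloisRepresentations.IsNonarchimedeanLocalField
open Literature.NumberTheory.Rogawski1990 (finprod_eq_finprod_prod_placesOver)
open Summit.HodgeConjecture.HodgeConjecture.Cruxes.H413.AdelicProductIntegral
open Summit.HodgeConjecture.HodgeConjecture.Cruxes.H413.K2E1IntertwiningLocalHeightU3 (continuous_localHeight_rpow)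
open Summit.HodgeConjecture.HodgeConjecture.Cruxes.H413.K2E1IntertwiningLocalMeanCMU3 (localHeight_eq_one_of_mem_integralBox)
open Summit.HodgeConjecture.HodgeConjecture.Cruxes.H413.K2E1IntertwiningFiniteHeightDictionaryU3 (quadraticFiniteAdeleMap_apply_placesOver)
open Summit.HodgeConjecture.HodgeConjecture.Cruxes.H413.K2E1AdelicFourierCoeffEulerProduct (coe_finiteAdeleAddChar_mul_eq_finprod finite_mulSupport_localFactor algebraMap_mul_apply)

namespace Summit.HodgeConjecture.HodgeConjecture.Cruxes.H413.K2E1WhittakerCoefficientEulerProductU3B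

/-! ## §0 Generic: a factorizable function with continuous local factors, `= 1` on the boxes off `S₀`, is finitely supported at each point and continuous -/

section Generic

variable {K : Type} [Field K] [NumberField K] {ι : Type} [Finite ι]
  (f : ∀ v : HeightOneSpectrum (𝓞 K), (ι → v.adicCompletion K) → ℂ) (S₀ : Finset (HeightOneSpectrum (𝓞 K)))

/-- **At every adelic vector `x` only finitely many local factors `f_v(x_v)` differ from `1`** (`x` is integral off a finite `T` ★ `exists_finset_mem_offBox`; off `S₀ ∪ T` the factor is
`f_v(𝒪_v^ι-point) = 1`). [cite: TateThesis1967, §3.3] -/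
theorem finite_mulSupport_localFactor_pi (hf1 : ∀ v ∉ S₀, ∀ z ∈ integralBox K ι v, f v z = 1) (x : ι → FiniteAdeleRing (𝓞 K) K) :
    (mulSupport fun v => f v fun i => x i v).Finite := by
  classical
  obtain ⟨T, hT⟩ := exists_finset_mem_offBox x
  refine (S₀ ∪ T).finite_toSet.subset fun v hv => ?_
  by_contra h
  rw [Finset.coe_union, mem_union, not_or, Finset.mem_coe, Finset.mem_coe] at h
  exact hv (hf1 v h.1 _ (mem_integralBox_iff.2 fun i => hT i v h.2))

/-- **A FACTORIZABLE FUNCTION WITH CONTINUOUS LOCAL FACTORS IS CONTINUOUS ON `(𝔸_{K,f})^ι`**: near any point `x ∈ offBox T` (an OPEN box, `T ⊇ S₀`) the Euler product `∏ᶠ_v f_v(y_v)` is the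
finite product `∏_{v ∈ T} f_v(y_v)` (★ `finprod_localFactor_eq_prod_of_mem_offBox`), a continuous function of `y` (the evaluations `y ↦ (y_i)_v` are continuous on the restricted
product).  This is the measurability half of the integrability letters of ★ `AdelicProductIntegral.hasProd_localIntegral_of_integrable`. [cite: TateThesis1967, §3.3, Lemma 3.3.2] -/
theorem continuous_finprod_localFactor (hcont : ∀ v, Continuous (f v)) (hf1 : ∀ v ∉ S₀, ∀ z ∈ integralBox K ι v, f v z = 1) :
    Continuous fun x : ι → FiniteAdeleRing (𝓞 K) K => ∏ᶠ v, f v fun i => x i v := by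
  classical
  refine continuous_iff_continuousAt.2 fun x => ?_
  obtain ⟨T, hT⟩ := exists_finset_mem_offBox x
  have hx : x ∈ offBox (S₀ ∪ T) := offBox_mono Finset.subset_union_right hT
  have hfin : Continuous fun y : ι → FiniteAdeleRing (𝓞 K) K => ∏ v ∈ S₀ ∪ T, f v fun i => y i v :=
    continuous_finsetProd _ fun v _ => (hcont v).comp (continuous_pi fun i => (RestrictedProduct.continuous_eval v).comp (continuous_apply i))
  refine hfin.continuousAt.congr (eventuallyEq_of_mem ((isOpen_offBox (S₀ ∪ T)).mem_nhds hx) fun y hy => ?_)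
  exact (finprod_localFactor_eq_prod_of_mem_offBox f S₀ hf1 Finset.subset_union_left hy).symm

end Generic

/-! ## §1 One place `v` of `L⁺`: the ψ-twisted local factor `f_v(p) = Q_v(p)^{−z}·∏_{w∣v} ψ_{L,w}(ξ_w·Ψ_v(p₀,p₁)_w)` -/

variable (L : Type) [Field L] [NumberField L] [IsCMField L] {δ : L} (hcδ : IsCMField.complexConj L δ = -δ) (hδ : δ ≠ 0)
  {d : ↥(maximalRealSubfield L)} (hd : δ * δ = algebraMap ↥(maximalRealSubfield L) L d)
  (v : HeightOneSpectrum (𝓞 ↥(maximalRealSubfield L)))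

/-- **The local height `Q_v` is continuous** on `(L⁺_v)³` (★ (3-iii-a) `continuous_localHeight_rpow` at exponent `1`). [cite: TateThesis1967, §3.3] -/
theorem continuous_localHeight :
    Continuous fun p : Fin 3 → v.adicCompletion ↥(maximalRealSubfield L) =>
      (∏ w' : PlacesOver L v, max 1 (max ((normAbs (w'.1.adicCompletion L) (quadraticLocalEquiv L v (IsCMField.complexConj L) hcδ hδ (p 0, p 1) w') : ℝ≥0) : ℝ)
          ((normAbs (w'.1.adicCompletion L) ((toLocalRing L v (p 2) * algebraMap L (LocalRing L v) δ -
            toLocalRing L v 2⁻¹ * (quadraticLocalEquiv L v (IsCMField.complexConj L) hcδ hδ (p 0, p 1) *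
              conjLocal L (IsCMField.complexConj L) v (quadraticLocalEquiv L v (IsCMField.complexConj L) hcδ hδ (p 0, p 1)))) w') : ℝ≥0) : ℝ))) := by
  have h := continuous_localHeight_rpow L (IsCMField.complexConj L) hcδ hδ v (-1)
  simp only [neg_neg, Real.rpow_one] at h
  exact h

/-- **`Ψ_v(𝒪_v²) ⊆ ∏_{w∣v} 𝒪_w` when `δ` is a unit (indeed whenever `δ` is integral) at every `w ∣ v`**: `Ψ_v(a,b)_w = ι_w(a) + ι_w(b)·δ` (★ `quadraticLocalEquiv_apply`,
★ `toLocalRing_mem_adicCompletionIntegers`). [cite: CasselsFrohlichANT1967, Ch. II §10] -/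
theorem quadraticLocalEquiv_apply_mem_adicCompletionIntegers
    (hδu : ∀ w : PlacesOver L v, Valued.v (algebraMap L (LocalRing L v) δ w) = 1) {a b : v.adicCompletion ↥(maximalRealSubfield L)}
    (ha : a ∈ v.adicCompletionIntegers ↥(maximalRealSubfield L)) (hb : b ∈ v.adicCompletionIntegers ↥(maximalRealSubfield L)) (w' : PlacesOver L v) :
    quadraticLocalEquiv L v (IsCMField.complexConj L) hcδ hδ (a, b) w' ∈ w'.1.adicCompletionIntegers L := by
  rw [quadraticLocalEquiv_apply, Pi.add_apply, Pi.mul_apply]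
  refine add_mem (toLocalRing_mem_adicCompletionIntegers L v ha w') (mul_mem (toLocalRing_mem_adicCompletionIntegers L v hb w') ?_)
  rw [HeightOneSpectrum.mem_adicCompletionIntegers]
  exact (hδu w').le

include hd in
/-- **`Q_v(p)^{−z} = 1` on the box `𝒪_v³` at a good place** (`v` unramified in `L`, `|2|_v = 1`, `δ` a `w`-unit for all `w ∣ v`: ★ (3-iii-b1) `localHeight_eq_one_of_mem_integralBox`), for
every complex exponent `z`. [cite: Langlands1971, §3] -/
theorem ofReal_localHeight_cpow_eq_one_of_mem_integralBox (hunr : Algebra.IsUnramifiedIn (𝓞 L) v.asIdeal)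
    (h2 : Valued.v (2 : v.adicCompletion ↥(maximalRealSubfield L)) = 1) (hδu : ∀ w : PlacesOver L v, Valued.v (algebraMap L (LocalRing L v) δ w) = 1) (z : ℂ)
    {p : Fin 3 → v.adicCompletion ↥(maximalRealSubfield L)} (hp : p ∈ integralBox ↥(maximalRealSubfield L) (Fin 3) v) :
    ((((∏ w' : PlacesOver L v, max 1 (max ((normAbs (w'.1.adicCompletion L) (quadraticLocalEquiv L v (IsCMField.complexConj L) hcδ hδ (p 0, p 1) w') : ℝ≥0) : ℝ)
          ((normAbs (w'.1.adicCompletion L) ((toLocalRing L v (p 2) * algebraMap L (LocalRing L v) δ -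
            toLocalRing L v 2⁻¹ * (quadraticLocalEquiv L v (IsCMField.complexConj L) hcδ hδ (p 0, p 1) *
              conjLocal L (IsCMField.complexConj L) v (quadraticLocalEquiv L v (IsCMField.complexConj L) hcδ hδ (p 0, p 1)))) w') : ℝ≥0) : ℝ))) : ℝ) : ℂ) ^ (-z)) = 1 := by
  rw [localHeight_eq_one_of_mem_integralBox L hcδ hδ hd v hunr h2 hδu hp, Complex.ofReal_one, Complex.one_cpow]

/-- **The character factor `∏_{w∣v} ψ_{L,w}(ξ_w·Ψ_v(p₀,p₁)_w) = 1` on the box `𝒪_v³`** when `δ` is a `w`-unit and `ξ_w ∈ 𝒪_w` for every `w ∣ v` (`ψ_{L,w}` is trivial on `𝒪_w` at EVERY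
`w`, ★ `adeleAddCharAt_eq_one_of_mem` — no conductor bookkeeping). [cite: TateThesis1967, §4.1] -/
theorem prod_adeleAddCharAt_eq_one_of_mem_integralBox (hδu : ∀ w : PlacesOver L v, Valued.v (algebraMap L (LocalRing L v) δ w) = 1)
    (ξw : ∀ w' : PlacesOver L v, w'.1.adicCompletion L) (hξ : ∀ w' : PlacesOver L v, ξw w' ∈ w'.1.adicCompletionIntegers L)
    {p : Fin 3 → v.adicCompletion ↥(maximalRealSubfield L)} (hp : p ∈ integralBox ↥(maximalRealSubfield L) (Fin 3) v) :
    (∏ w' : PlacesOver L v, (adeleAddCharAt L w'.1 (ξw w' * quadraticLocalEquiv L v (IsCMField.complexConj L) hcδ hδ (p 0, p 1) w') : ℂ)) = 1 :=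
  Finset.prod_eq_one fun w' _ => by
    rw [adeleAddCharAt_eq_one_of_mem L w'.1 (mul_mem (hξ w') (quadraticLocalEquiv_apply_mem_adicCompletionIntegers L hcδ hδ v
      hδu (mem_integralBox_iff.1 hp 0) (mem_integralBox_iff.1 hp 1) w')), Circle.coe_one]

/-- **The ψ-twisted local factor `f_v(p) = Q_v(p)^{−z}·∏_{w∣v} ψ_{L,w}(ξ_w·Ψ_v(p₀,p₁)_w)` is continuous** (`Q_v ≥ 1` lies in the slit plane; `Ψ_v` is a `ContinuousLinearEquiv`;
★ `continuous_adeleAddCharAt`). [cite: TateThesis1967, §3.3] -/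
theorem continuous_twistedLocalFactor (z : ℂ) (ξw : ∀ w' : PlacesOver L v, w'.1.adicCompletion L) :
    Continuous fun p : Fin 3 → v.adicCompletion ↥(maximalRealSubfield L) =>
      ((((∏ w' : PlacesOver L v, max 1 (max ((normAbs (w'.1.adicCompletion L) (quadraticLocalEquiv L v (IsCMField.complexConj L) hcδ hδ (p 0, p 1) w') : ℝ≥0) : ℝ)
          ((normAbs (w'.1.adicCompletion L) ((toLocalRing L v (p 2) * algebraMap L (LocalRing L v) δ -
            toLocalRing L v 2⁻¹ * (quadraticLocalEquiv L v (IsCMField.complexConj L) hcδ hδ (p 0, p 1) *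
              conjLocal L (IsCMField.complexConj L) v (quadraticLocalEquiv L v (IsCMField.complexConj L) hcδ hδ (p 0, p 1)))) w') : ℝ≥0) : ℝ))) : ℝ) : ℂ) ^ (-z)) *
        (∏ w' : PlacesOver L v, (adeleAddCharAt L w'.1 (ξw w' * quadraticLocalEquiv L v (IsCMField.complexConj L) hcδ hδ (p 0, p 1) w') : ℂ)) := by
  have hQ := continuous_localHeight L hcδ hδ v
  have hΨ : Continuous fun p : Fin 3 → v.adicCompletion ↥(maximalRealSubfield L) => quadraticLocalEquiv L v (IsCMField.complexConj L) hcδ hδ (p 0, p 1) :=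
    (quadraticLocalEquiv L v (IsCMField.complexConj L) hcδ hδ).continuous.comp ((continuous_apply 0).prodMk (continuous_apply 1))
  refine (((Complex.continuous_ofReal.comp hQ).cpow continuous_const fun p => ?_).mul (continuous_finsetProd _ fun w' _ => ?_))
  · exact Complex.ofReal_mem_slitPlane.2 (lt_of_lt_of_le one_pos (Finset.one_le_prod fun w' _ => le_max_left _ _))
  · exact continuous_subtype_val.comp ((continuous_adeleAddCharAt L w'.1).comp (continuous_const.mul ((continuous_apply w').comp hΨ)))

include hd in
/-- **`f_v = 1` ON THE BOX `𝒪_v³` AT A GOOD PLACE** (`v` unramified in `L`, `|2|_v = 1`, `δ` a `w`-unit and `ξ_w ∈ 𝒪_w` for every `w ∣ v`): the `hf1` hypothesis of ★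
`AdelicProductIntegral.hasProd_localIntegral_of_integrable` for the twisted factors. [cite: TateThesis1967, Thm 3.3.1] -/
theorem twistedLocalFactor_eq_one_of_mem_integralBox (hunr : Algebra.IsUnramifiedIn (𝓞 L) v.asIdeal)
    (h2 : Valued.v (2 : v.adicCompletion ↥(maximalRealSubfield L)) = 1) (hδu : ∀ w : PlacesOver L v, Valued.v (algebraMap L (LocalRing L v) δ w) = 1) (z : ℂ)
    (ξw : ∀ w' : PlacesOver L v, w'.1.adicCompletion L) (hξ : ∀ w' : PlacesOver L v, ξw w' ∈ w'.1.adicCompletionIntegers L)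
    {p : Fin 3 → v.adicCompletion ↥(maximalRealSubfield L)} (hp : p ∈ integralBox ↥(maximalRealSubfield L) (Fin 3) v) :
    ((((∏ w' : PlacesOver L v, max 1 (max ((normAbs (w'.1.adicCompletion L) (quadraticLocalEquiv L v (IsCMField.complexConj L) hcδ hδ (p 0, p 1) w') : ℝ≥0) : ℝ)
          ((normAbs (w'.1.adicCompletion L) ((toLocalRing L v (p 2) * algebraMap L (LocalRing L v) δ -
            toLocalRing L v 2⁻¹ * (quadraticLocalEquiv L v (IsCMField.complexConj L) hcδ hδ (p 0, p 1) *
              conjLocal L (IsCMField.complexConj L) v (quadraticLocalEquiv L v (IsCMField.complexConj L) hcδ hδ (p 0, p 1)))) w') : ℝ≥0) : ℝ))) : ℝ) : ℂ) ^ (-z)) *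
        (∏ w' : PlacesOver L v, (adeleAddCharAt L w'.1 (ξw w' * quadraticLocalEquiv L v (IsCMField.complexConj L) hcδ hδ (p 0, p 1) w') : ℂ)) = 1 := by
  rw [ofReal_localHeight_cpow_eq_one_of_mem_integralBox L hcδ hδ hd v hunr h2 hδu z hp,
    prod_adeleAddCharAt_eq_one_of_mem_integralBox L hcδ hδ v hδu ξw hξ hp, one_mul]

/-- **`|f_v(p)| = Q_v(p)^{−Re z}`** (`Q_v > 0` real, `|ψ| = 1`): the twisted local factor has the modulus of ★ FILE 3's local factor at `σ = Re z`. [cite: TateThesis1967, §3.3] -/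
theorem norm_twistedLocalFactor_eq (z : ℂ) (ξw : ∀ w' : PlacesOver L v, w'.1.adicCompletion L) (p : Fin 3 → v.adicCompletion ↥(maximalRealSubfield L)) :
    ‖((((∏ w' : PlacesOver L v, max 1 (max ((normAbs (w'.1.adicCompletion L) (quadraticLocalEquiv L v (IsCMField.complexConj L) hcδ hδ (p 0, p 1) w') : ℝ≥0) : ℝ)
          ((normAbs (w'.1.adicCompletion L) ((toLocalRing L v (p 2) * algebraMap L (LocalRing L v) δ -
            toLocalRing L v 2⁻¹ * (quadraticLocalEquiv L v (IsCMField.complexConj L) hcδ hδ (p 0, p 1) *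
              conjLocal L (IsCMField.complexConj L) v (quadraticLocalEquiv L v (IsCMField.complexConj L) hcδ hδ (p 0, p 1)))) w') : ℝ≥0) : ℝ))) : ℝ) : ℂ) ^ (-z)) *
        (∏ w' : PlacesOver L v, (adeleAddCharAt L w'.1 (ξw w' * quadraticLocalEquiv L v (IsCMField.complexConj L) hcδ hδ (p 0, p 1) w') : ℂ))‖ =
      (∏ w' : PlacesOver L v, max 1 (max ((normAbs (w'.1.adicCompletion L) (quadraticLocalEquiv L v (IsCMField.complexConj L) hcδ hδ (p 0, p 1) w') : ℝ≥0) : ℝ)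
          ((normAbs (w'.1.adicCompletion L) ((toLocalRing L v (p 2) * algebraMap L (LocalRing L v) δ -
            toLocalRing L v 2⁻¹ * (quadraticLocalEquiv L v (IsCMField.complexConj L) hcδ hδ (p 0, p 1) *
              conjLocal L (IsCMField.complexConj L) v (quadraticLocalEquiv L v (IsCMField.complexConj L) hcδ hδ (p 0, p 1)))) w') : ℝ≥0) : ℝ))) ^ (-z.re) := by
  rw [norm_mul, Complex.norm_cpow_eq_rpow_re_of_pos (lt_of_lt_of_le one_pos (Finset.one_le_prod fun w' _ => le_max_left _ _)), norm_prod,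
    Finset.prod_eq_one (fun w' _ => Circle.norm_coe _), mul_one, Complex.neg_re]

omit [IsCMField L] in
/-- **The letter `hξ` holds off a finite set**: for `ξ ∈ L` there is a finset `S_ξ` of places of `L⁺` off which `ξ ∈ 𝒪_w` for every `w ∣ v` (`ξ` is a finite adele, integral at almost
every `w`; ★ `eventually_forall_placesOver`). [cite: CasselsFrohlichANT1967, Ch. II §14] -/
theorem exists_finset_forall_coe_mem_adicCompletionIntegers (ξ : L) :
    ∃ Sξ : Finset (HeightOneSpectrum (𝓞 ↥(maximalRealSubfield L))), ∀ v ∉ Sξ, ∀ w' : PlacesOver L v, (ξ : w'.1.adicCompletion L) ∈ w'.1.adicCompletionIntegers L := by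
  have h := eventually_forall_placesOver (F := ↥(maximalRealSubfield L)) L (Q := fun w => (ξ : w.adicCompletion L) ∈ w.adicCompletionIntegers L)
    (algebraMap L (FiniteAdeleRing (𝓞 L) L) ξ).2
  rw [Filter.eventually_cofinite] at h
  exact ⟨h.toFinset, fun v hv w' => by_contra fun hn => hv (h.mem_toFinset.2 fun hall => hn (hall w'))⟩

/-! ## §2 The global twisted integrand is factorizable: `∏ᶠ_v f_v(x_v) = (∏ᶠ_v Q_v(x_v)^{−z})·ψ_{L,f}(ξ·Ψ^∞(x₀,x₁))` -/

variable (S₀ : Finset (HeightOneSpectrum (𝓞 ↥(maximalRealSubfield L))))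

include hd in
/-- **THE TWISTED INTEGRAND IS FACTORIZABLE**: for `x ∈ (𝔸_{L⁺,f})³`, `∏ᶠ_v [Q_v(x_v)^{−z}·∏_{w∣v} ψ_{L,w}(ξ·Ψ_v(x₀|_v,x₁|_v)_w)] = (∏ᶠ_v Q_v(x_v)^{−z}) · ψ_{L,f}(ξ·Ψ^∞(x₀,x₁))` — both
factor families are finitely supported (§0 with §1 at the good places off `S₀`), `ψ_{L,f}(ξy) = ∏ᶠ_w ψ_{L,w}(ξ y_w)` (★ W3-engine `coe_finiteAdeleAddChar_mul_eq_finprod`) regrouped over the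
places of `L⁺` (★ `finprod_eq_finprod_prod_placesOver`), and `Ψ^∞(x₀,x₁)_w = Ψ_v(x₀|_v,x₁|_v)_w` (★ (3-iv-a) `quadraticFiniteAdeleMap_apply_placesOver`).
[cite: TateThesis1967, §3.3 and §4.1] [cite: CasselsFrohlichANT1967, Ch. II §11] -/
theorem finprod_twistedLocalFactor_eq
    (hgood : ∀ v ∉ S₀, Algebra.IsUnramifiedIn (𝓞 L) v.asIdeal ∧ Valued.v (2 : v.adicCompletion ↥(maximalRealSubfield L)) = 1 ∧
      ∀ w : PlacesOver L v, Valued.v (algebraMap L (LocalRing L v) δ w) = 1)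
    (z : ℂ) (ξ : L) (hξ : ∀ v ∉ S₀, ∀ w' : PlacesOver L v, (ξ : w'.1.adicCompletion L) ∈ w'.1.adicCompletionIntegers L)
    (x : Fin 3 → FiniteAdeleRing (𝓞 ↥(maximalRealSubfield L)) ↥(maximalRealSubfield L)) :
    ∏ᶠ v : HeightOneSpectrum (𝓞 ↥(maximalRealSubfield L)),
        ((((∏ w' : PlacesOver L v, max 1 (max ((normAbs (w'.1.adicCompletion L) (quadraticLocalEquiv L v (IsCMField.complexConj L) hcδ hδ (x 0 v, x 1 v) w') : ℝ≥0) : ℝ)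
          ((normAbs (w'.1.adicCompletion L) ((toLocalRing L v (x 2 v) * algebraMap L (LocalRing L v) δ -
            toLocalRing L v 2⁻¹ * (quadraticLocalEquiv L v (IsCMField.complexConj L) hcδ hδ (x 0 v, x 1 v) *
              conjLocal L (IsCMField.complexConj L) v (quadraticLocalEquiv L v (IsCMField.complexConj L) hcδ hδ (x 0 v, x 1 v)))) w') : ℝ≥0) : ℝ))) : ℝ) : ℂ) ^ (-z)) *
          (∏ w' : PlacesOver L v, (adeleAddCharAt L w'.1 ((ξ : w'.1.adicCompletion L) * quadraticLocalEquiv L v (IsCMField.complexConj L) hcδ hδ (x 0 v, x 1 v) w') : ℂ)) =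
      (∏ᶠ v : HeightOneSpectrum (𝓞 ↥(maximalRealSubfield L)),
        ((((∏ w' : PlacesOver L v, max 1 (max ((normAbs (w'.1.adicCompletion L) (quadraticLocalEquiv L v (IsCMField.complexConj L) hcδ hδ (x 0 v, x 1 v) w') : ℝ≥0) : ℝ)
          ((normAbs (w'.1.adicCompletion L) ((toLocalRing L v (x 2 v) * algebraMap L (LocalRing L v) δ -
            toLocalRing L v 2⁻¹ * (quadraticLocalEquiv L v (IsCMField.complexConj L) hcδ hδ (x 0 v, x 1 v) *
              conjLocal L (IsCMField.complexConj L) v (quadraticLocalEquiv L v (IsCMField.complexConj L) hcδ hδ (x 0 v, x 1 v)))) w') : ℝ≥0) : ℝ))) : ℝ) : ℂ) ^ (-z))) *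
        (finiteAdeleAddChar L (algebraMap L (FiniteAdeleRing (𝓞 L) L) ξ * quadraticFiniteAdeleMap ↥(maximalRealSubfield L) L δ (x 0, x 1)) : ℂ) := by
  have hQ : (mulSupport fun v : HeightOneSpectrum (𝓞 ↥(maximalRealSubfield L)) =>
      ((((∏ w' : PlacesOver L v, max 1 (max ((normAbs (w'.1.adicCompletion L) (quadraticLocalEquiv L v (IsCMField.complexConj L) hcδ hδ (x 0 v, x 1 v) w') : ℝ≥0) : ℝ)
          ((normAbs (w'.1.adicCompletion L) ((toLocalRing L v (x 2 v) * algebraMap L (LocalRing L v) δ -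
            toLocalRing L v 2⁻¹ * (quadraticLocalEquiv L v (IsCMField.complexConj L) hcδ hδ (x 0 v, x 1 v) *
              conjLocal L (IsCMField.complexConj L) v (quadraticLocalEquiv L v (IsCMField.complexConj L) hcδ hδ (x 0 v, x 1 v)))) w') : ℝ≥0) : ℝ))) : ℝ) : ℂ) ^ (-z))).Finite :=
    finite_mulSupport_localFactor_pi (fun v p => ((((∏ w' : PlacesOver L v, max 1 (max ((normAbs (w'.1.adicCompletion L) (quadraticLocalEquiv L v (IsCMField.complexConj L) hcδ hδ (p 0, p 1) w') : ℝ≥0) : ℝ)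
          ((normAbs (w'.1.adicCompletion L) ((toLocalRing L v (p 2) * algebraMap L (LocalRing L v) δ -
            toLocalRing L v 2⁻¹ * (quadraticLocalEquiv L v (IsCMField.complexConj L) hcδ hδ (p 0, p 1) *
              conjLocal L (IsCMField.complexConj L) v (quadraticLocalEquiv L v (IsCMField.complexConj L) hcδ hδ (p 0, p 1)))) w') : ℝ≥0) : ℝ))) : ℝ) : ℂ) ^ (-z))) S₀
      (fun v hv p hp => ofReal_localHeight_cpow_eq_one_of_mem_integralBox L hcδ hδ hd v (hgood v hv).1 (hgood v hv).2.1 (hgood v hv).2.2 z hp) x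
  have hΨ : (mulSupport fun v : HeightOneSpectrum (𝓞 ↥(maximalRealSubfield L)) =>
      (∏ w' : PlacesOver L v, (adeleAddCharAt L w'.1 ((ξ : w'.1.adicCompletion L) * quadraticLocalEquiv L v (IsCMField.complexConj L) hcδ hδ (x 0 v, x 1 v) w') : ℂ))).Finite :=
    finite_mulSupport_localFactor_pi (fun v p => (∏ w' : PlacesOver L v, (adeleAddCharAt L w'.1 ((ξ : w'.1.adicCompletion L) * quadraticLocalEquiv L v (IsCMField.complexConj L) hcδ hδ (p 0, p 1) w') : ℂ))) S₀
      (fun v hv p hp => prod_adeleAddCharAt_eq_one_of_mem_integralBox L hcδ hδ v (hgood v hv).2.2 (fun w' => (ξ : w'.1.adicCompletion L)) (hξ v hv) hp) x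
  have hw : (mulSupport fun w : HeightOneSpectrum (𝓞 L) =>
      (adeleAddCharAt L w ((ξ : w.adicCompletion L) * quadraticFiniteAdeleMap ↥(maximalRealSubfield L) L δ (x 0, x 1) w) : ℂ)).Finite :=
    finite_mulSupport_localFactor L (S := ∅) (g := fun w t => (adeleAddCharAt L w t : ℂ)) (fun w _ t ht => by rw [adeleAddCharAt_eq_one_of_mem L w ht, Circle.coe_one])
      (algebraMap L (FiniteAdeleRing (𝓞 L) L) ξ * quadraticFiniteAdeleMap ↥(maximalRealSubfield L) L δ (x 0, x 1))
  rw [finprod_mul_distrib hQ hΨ, coe_finiteAdeleAddChar_mul_eq_finprod L ξ,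
    finprod_eq_finprod_prod_placesOver ↥(maximalRealSubfield L) (fun w : HeightOneSpectrum (𝓞 L) =>
      (adeleAddCharAt L w ((ξ : w.adicCompletion L) * quadraticFiniteAdeleMap ↥(maximalRealSubfield L) L δ (x 0, x 1) w) : ℂ)) hw]
  congr 1
  exact finprod_congr fun v => Finset.prod_congr rfl fun w' _ => by rw [quadraticFiniteAdeleMap_apply_placesOver L hcδ hδ (x 0) (x 1) v w']

/-! ## §3 HEAD: Tate's Theorem 3.3.1 for the ψ-twisted integrand — the `hprod` letter of ★ W3₃ FILE A -/

variable [MeasurableSpace (FiniteAdeleRing (𝓞 ↥(maximalRealSubfield L)) ↥(maximalRealSubfield L))] [BorelSpace (FiniteAdeleRing (𝓞 ↥(maximalRealSubfield L)) ↥(maximalRealSubfield L))]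
  [∀ v : HeightOneSpectrum (𝓞 ↥(maximalRealSubfield L)), MeasurableSpace (v.adicCompletion ↥(maximalRealSubfield L))]
  [∀ v : HeightOneSpectrum (𝓞 ↥(maximalRealSubfield L)), BorelSpace (v.adicCompletion ↥(maximalRealSubfield L))]
  (μ : Measure (Fin 3 → FiniteAdeleRing (𝓞 ↥(maximalRealSubfield L)) ↥(maximalRealSubfield L))) [μ.IsAddHaarMeasure]
  (νv : ∀ v : HeightOneSpectrum (𝓞 ↥(maximalRealSubfield L)), Measure (v.adicCompletion ↥(maximalRealSubfield L))) [∀ v, (νv v).IsAddHaarMeasure]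

include hd in
/-- **THE FINITE WHITTAKER EULER PRODUCT OF `U(2,1)_{L∕L⁺}` — the `hprod` letter of ★ W3₃ FILE A `K2E1WhittakerCoefficientEulerProductU3.whittakerCoeff_eq_prod_of_inputs`.**  Data: the CM pair
`L ∕ L⁺` with `δ` (`hcδ hδ hd`), additive Haar measures `μ` on `(𝔸_{L⁺,f})³` and `ν_v` on the `L⁺_v`, a finset `S₀` with ★ FILE 3's letter `hgood` (off `S₀`: `v` unramified in `L`,
`|2|_v = 1`, `δ` a unit at every `w ∣ v`), a frequency `ξ ∈ L` integral above every `v ∉ S₀` (letter `hξ`; enlarge `S₀` by §1 `exists_finset_forall_coe_mem_adicCompletionIntegers`), a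
complex exponent `z`, and ★ FILE 3's integrability letter `hint` for `F(x) = ∏ᶠ_v Q_v(x_v)^{−z}` at the exponent `z`.  THEN, with the local Whittaker factors
`W_v(ξ, z) := ν_v(𝒪_v³)⁻¹·∫_{(L⁺_v)³} Q_v(p)^{−z}·∏_{w∣v} ψ_{L,w}(ξ·Ψ_v(p₀,p₁)_w) dν_v³`,
**`HasProd (v ↦ W_v(ξ, z)) (μ(𝒪̂³)⁻¹·∫_{(𝔸_{L⁺,f})³} F(x)·ψ_{L,f}(ξ·Ψ^∞(x₀,x₁)) dμ)`** — ★ `AdelicProductIntegral.hasProd_localIntegral_of_integrable` (`K = L⁺`, `ι = Fin 3`, `ν_v³ = ν_v⊗ν_v⊗ν_v`)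
at the twisted local factors (§1: continuous, `= 1` on `𝒪_v³` off `S₀`), whose Euler product is `F·ψ_{L,f}(ξΨ^∞)` (§2), integrable as `|ψ_{L,f}| = 1` and `ψ_{L,f}`, `Ψ^∞` are continuous.
[cite: TateThesis1967, Thm 3.3.1] [cite: Bump1997, §3.7] [cite: Rogawski1990, §4.5] -/
theorem hasProd_localWhittaker_three
    (hgood : ∀ v ∉ S₀, Algebra.IsUnramifiedIn (𝓞 L) v.asIdeal ∧ Valued.v (2 : v.adicCompletion ↥(maximalRealSubfield L)) = 1 ∧
      ∀ w : PlacesOver L v, Valued.v (algebraMap L (LocalRing L v) δ w) = 1)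
    (z : ℂ) (ξ : L) (hξ : ∀ v ∉ S₀, ∀ w' : PlacesOver L v, (ξ : w'.1.adicCompletion L) ∈ w'.1.adicCompletionIntegers L)
    (hint : Integrable (fun x : Fin 3 → FiniteAdeleRing (𝓞 ↥(maximalRealSubfield L)) ↥(maximalRealSubfield L) =>
      ∏ᶠ v : HeightOneSpectrum (𝓞 ↥(maximalRealSubfield L)),
        ((((∏ w' : PlacesOver L v, max 1 (max ((normAbs (w'.1.adicCompletion L) (quadraticLocalEquiv L v (IsCMField.complexConj L) hcδ hδ (x 0 v, x 1 v) w') : ℝ≥0) : ℝ)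
          ((normAbs (w'.1.adicCompletion L) ((toLocalRing L v (x 2 v) * algebraMap L (LocalRing L v) δ -
            toLocalRing L v 2⁻¹ * (quadraticLocalEquiv L v (IsCMField.complexConj L) hcδ hδ (x 0 v, x 1 v) *
              conjLocal L (IsCMField.complexConj L) v (quadraticLocalEquiv L v (IsCMField.complexConj L) hcδ hδ (x 0 v, x 1 v)))) w') : ℝ≥0) : ℝ))) : ℝ) : ℂ) ^ (-z))) μ) :
    HasProd (fun v : HeightOneSpectrum (𝓞 ↥(maximalRealSubfield L)) =>
        ((Measure.pi fun _ : Fin 3 => νv v) (integralBox ↥(maximalRealSubfield L) (Fin 3) v)).toReal⁻¹ •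
          ∫ p : Fin 3 → v.adicCompletion ↥(maximalRealSubfield L),
            ((((∏ w' : PlacesOver L v, max 1 (max ((normAbs (w'.1.adicCompletion L) (quadraticLocalEquiv L v (IsCMField.complexConj L) hcδ hδ (p 0, p 1) w') : ℝ≥0) : ℝ)
          ((normAbs (w'.1.adicCompletion L) ((toLocalRing L v (p 2) * algebraMap L (LocalRing L v) δ -
            toLocalRing L v 2⁻¹ * (quadraticLocalEquiv L v (IsCMField.complexConj L) hcδ hδ (p 0, p 1) *
              conjLocal L (IsCMField.complexConj L) v (quadraticLocalEquiv L v (IsCMField.complexConj L) hcδ hδ (p 0, p 1)))) w') : ℝ≥0) : ℝ))) : ℝ) : ℂ) ^ (-z)) *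
              (∏ w' : PlacesOver L v, (adeleAddCharAt L w'.1 ((ξ : w'.1.adicCompletion L) * quadraticLocalEquiv L v (IsCMField.complexConj L) hcδ hδ (p 0, p 1) w') : ℂ))
            ∂(Measure.pi fun _ : Fin 3 => νv v))
      ((μ (offBox (K := ↥(maximalRealSubfield L)) (ι := Fin 3) ∅)).toReal⁻¹ •
        ∫ x : Fin 3 → FiniteAdeleRing (𝓞 ↥(maximalRealSubfield L)) ↥(maximalRealSubfield L),
          (∏ᶠ v : HeightOneSpectrum (𝓞 ↥(maximalRealSubfield L)),
            ((((∏ w' : PlacesOver L v, max 1 (max ((normAbs (w'.1.adicCompletion L) (quadraticLocalEquiv L v (IsCMField.complexConj L) hcδ hδ (x 0 v, x 1 v) w') : ℝ≥0) : ℝ)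
          ((normAbs (w'.1.adicCompletion L) ((toLocalRing L v (x 2 v) * algebraMap L (LocalRing L v) δ -
            toLocalRing L v 2⁻¹ * (quadraticLocalEquiv L v (IsCMField.complexConj L) hcδ hδ (x 0 v, x 1 v) *
              conjLocal L (IsCMField.complexConj L) v (quadraticLocalEquiv L v (IsCMField.complexConj L) hcδ hδ (x 0 v, x 1 v)))) w') : ℝ≥0) : ℝ))) : ℝ) : ℂ) ^ (-z))) *
            (finiteAdeleAddChar L (algebraMap L (FiniteAdeleRing (𝓞 L) L) ξ * quadraticFiniteAdeleMap ↥(maximalRealSubfield L) L δ (x 0, x 1)) : ℂ) ∂μ) := by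
  haveI : ∀ v : HeightOneSpectrum (𝓞 ↥(maximalRealSubfield L)), SecondCountableTopology (v.adicCompletion ↥(maximalRealSubfield L)) :=
    fun v => secondCountableTopology_localField _
  haveI : ∀ v : HeightOneSpectrum (𝓞 ↥(maximalRealSubfield L)), SigmaCompactSpace (v.adicCompletion ↥(maximalRealSubfield L)) :=
    fun v => sigmaCompactSpace_of_isNonarchimedeanLocalField _
  haveI : SecondCountableTopology (FiniteAdeleRing (𝓞 ↥(maximalRealSubfield L)) ↥(maximalRealSubfield L)) := secondCountableTopology_finiteAdeleRing _
  have hpt := finprod_twistedLocalFactor_eq L hcδ hδ hd S₀ hgood z ξ hξ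
  -- integrability of the twisted integrand: `|ψ_{L,f}| = 1`, `ψ_{L,f} ∘ (ξ·Ψ^∞)` continuous
  have hψ : Continuous fun x : Fin 3 → FiniteAdeleRing (𝓞 ↥(maximalRealSubfield L)) ↥(maximalRealSubfield L) =>
      (finiteAdeleAddChar L (algebraMap L (FiniteAdeleRing (𝓞 L) L) ξ * quadraticFiniteAdeleMap ↥(maximalRealSubfield L) L δ (x 0, x 1)) : ℂ) :=
    continuous_subtype_val.comp ((continuous_finiteAdeleAddChar L).comp (continuous_const.mul
      ((continuous_quadraticFiniteAdeleMap (F := ↥(maximalRealSubfield L)) (E := L) δ).comp ((continuous_apply 0).prodMk (continuous_apply 1)))))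
  have hint' : Integrable (fun x : Fin 3 → FiniteAdeleRing (𝓞 ↥(maximalRealSubfield L)) ↥(maximalRealSubfield L) =>
      ∏ᶠ v : HeightOneSpectrum (𝓞 ↥(maximalRealSubfield L)),
        ((((∏ w' : PlacesOver L v, max 1 (max ((normAbs (w'.1.adicCompletion L) (quadraticLocalEquiv L v (IsCMField.complexConj L) hcδ hδ (x 0 v, x 1 v) w') : ℝ≥0) : ℝ)
          ((normAbs (w'.1.adicCompletion L) ((toLocalRing L v (x 2 v) * algebraMap L (LocalRing L v) δ -
            toLocalRing L v 2⁻¹ * (quadraticLocalEquiv L v (IsCMField.complexConj L) hcδ hδ (x 0 v, x 1 v) *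
              conjLocal L (IsCMField.complexConj L) v (quadraticLocalEquiv L v (IsCMField.complexConj L) hcδ hδ (x 0 v, x 1 v)))) w') : ℝ≥0) : ℝ))) : ℝ) : ℂ) ^ (-z)) *
          (∏ w' : PlacesOver L v, (adeleAddCharAt L w'.1 ((ξ : w'.1.adicCompletion L) * quadraticLocalEquiv L v (IsCMField.complexConj L) hcδ hδ (x 0 v, x 1 v) w') : ℂ))) μ :=
    (hint.mul_bdd (c := 1) hψ.aestronglyMeasurable (Eventually.of_forall fun x => by rw [Circle.norm_coe])).congr
      (Eventually.of_forall fun x => (hpt x).symm)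
  have h : HasProd (fun v : HeightOneSpectrum (𝓞 ↥(maximalRealSubfield L)) =>
        ((Measure.pi fun _ : Fin 3 => νv v) (integralBox ↥(maximalRealSubfield L) (Fin 3) v)).toReal⁻¹ •
          ∫ p : Fin 3 → v.adicCompletion ↥(maximalRealSubfield L),
            ((((∏ w' : PlacesOver L v, max 1 (max ((normAbs (w'.1.adicCompletion L) (quadraticLocalEquiv L v (IsCMField.complexConj L) hcδ hδ (p 0, p 1) w') : ℝ≥0) : ℝ)
          ((normAbs (w'.1.adicCompletion L) ((toLocalRing L v (p 2) * algebraMap L (LocalRing L v) δ -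
            toLocalRing L v 2⁻¹ * (quadraticLocalEquiv L v (IsCMField.complexConj L) hcδ hδ (p 0, p 1) *
              conjLocal L (IsCMField.complexConj L) v (quadraticLocalEquiv L v (IsCMField.complexConj L) hcδ hδ (p 0, p 1)))) w') : ℝ≥0) : ℝ))) : ℝ) : ℂ) ^ (-z)) *
              (∏ w' : PlacesOver L v, (adeleAddCharAt L w'.1 ((ξ : w'.1.adicCompletion L) * quadraticLocalEquiv L v (IsCMField.complexConj L) hcδ hδ (p 0, p 1) w') : ℂ))
            ∂(Measure.pi fun _ : Fin 3 => νv v))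
      ((μ (offBox (K := ↥(maximalRealSubfield L)) (ι := Fin 3) ∅)).toReal⁻¹ •
        ∫ x : Fin 3 → FiniteAdeleRing (𝓞 ↥(maximalRealSubfield L)) ↥(maximalRealSubfield L),
          ∏ᶠ v : HeightOneSpectrum (𝓞 ↥(maximalRealSubfield L)),
            ((((∏ w' : PlacesOver L v, max 1 (max ((normAbs (w'.1.adicCompletion L) (quadraticLocalEquiv L v (IsCMField.complexConj L) hcδ hδ (x 0 v, x 1 v) w') : ℝ≥0) : ℝ)
          ((normAbs (w'.1.adicCompletion L) ((toLocalRing L v (x 2 v) * algebraMap L (LocalRing L v) δ -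
            toLocalRing L v 2⁻¹ * (quadraticLocalEquiv L v (IsCMField.complexConj L) hcδ hδ (x 0 v, x 1 v) *
              conjLocal L (IsCMField.complexConj L) v (quadraticLocalEquiv L v (IsCMField.complexConj L) hcδ hδ (x 0 v, x 1 v)))) w') : ℝ≥0) : ℝ))) : ℝ) : ℂ) ^ (-z)) *
              (∏ w' : PlacesOver L v, (adeleAddCharAt L w'.1 ((ξ : w'.1.adicCompletion L) * quadraticLocalEquiv L v (IsCMField.complexConj L) hcδ hδ (x 0 v, x 1 v) w') : ℂ)) ∂μ) :=
    hasProd_localIntegral_of_integrable ↥(maximalRealSubfield L) (Fin 3) μ (fun v => Measure.pi fun _ : Fin 3 => νv v)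
      (fun v p => ((((∏ w' : PlacesOver L v, max 1 (max ((normAbs (w'.1.adicCompletion L) (quadraticLocalEquiv L v (IsCMField.complexConj L) hcδ hδ (p 0, p 1) w') : ℝ≥0) : ℝ)
          ((normAbs (w'.1.adicCompletion L) ((toLocalRing L v (p 2) * algebraMap L (LocalRing L v) δ -
            toLocalRing L v 2⁻¹ * (quadraticLocalEquiv L v (IsCMField.complexConj L) hcδ hδ (p 0, p 1) *
              conjLocal L (IsCMField.complexConj L) v (quadraticLocalEquiv L v (IsCMField.complexConj L) hcδ hδ (p 0, p 1)))) w') : ℝ≥0) : ℝ))) : ℝ) : ℂ) ^ (-z)) *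
        (∏ w' : PlacesOver L v, (adeleAddCharAt L w'.1 ((ξ : w'.1.adicCompletion L) * quadraticLocalEquiv L v (IsCMField.complexConj L) hcδ hδ (p 0, p 1) w') : ℂ)))
      S₀ (fun v => continuous_twistedLocalFactor L hcδ hδ v z fun w' => (ξ : w'.1.adicCompletion L))
      (fun v hv p hp => twistedLocalFactor_eq_one_of_mem_integralBox L hcδ hδ hd v (hgood v hv).1 (hgood v hv).2.1 (hgood v hv).2.2 z
        (fun w' => (ξ : w'.1.adicCompletion L)) (hξ v hv) hp) hint'
  rwa [integral_congr_ae (Eventually.of_forall hpt)] at h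

end Summit.HodgeConjecture.HodgeConjecture.Cruxes.H413.K2E1WhittakerCoefficientEulerProductU3B

end
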